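import Summits.BirchSwinnertonDyer.Rank1Residual.F1Sign2.MazurTateFittingShadowAtTwo
import Summits.BirchSwinnertonDyer.Rank1Residual.F1Sign2.DescentSignAtTwo
import Literature.NumberTheory.EllipticCurves.RootNumber
import Literature.NumberTheory.DiophantineGeometry.MinimalDiscriminant
import Mathlib.RingTheory.Polynomial.Resultant.Basic
import HarnessLib

/-!
# Cell `bsd-f1-sign2`, lens `-imc` g7 (MEMO-imc §10.62–§10.65): THE ADDITIVE THIRD OF X5 — the deflated new part of the Mazur–Tate
# element at additive `2` with Tate-algorithm bookkeeping; rows IMC-ADD2-DEFL `AdditiveMazurTateDeflationAtTwo` (support),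
# IMC-ADD2-W `MazurTateFittingShadowAdditiveAtTwoLe`, IMC-ADD2-SIGN `AdditiveNewPartSignLawAtTwo` (row of record),
# IMC-ADD2-INC `AdditiveNewPartShaIncrementAtTwo` (`@[conjecture]`)

TYPER FILING (cell `bsd-f1-sign2`, seat `-ty` g9; CANDIDATES.md rows IMC-ADD2-DEFL/W/SIGN/INC; -imc g7 CANDIDATES-delta 2026-08-28T10:46:45Z,
MEMO-imc §10.64): body VERBATIM from `HOME/MEMO-imc-data/dimc22/SketchG7Add2.lean` 91185957d674fe09 (from `noncomputable section` to the
final `end`; -imc: farm rc 0 · 0 err · 0 warn · 0 sorry; BC7 `ProbeG7Add2.lean` b2785beed54eb579 4/4 CLEAN) — five helper defs WITH BODIES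
(`newPartNormTwoVal`, `layerTwoMinDiscOrd`, `LayerAdditiveAboveTwo`, `layerMordellWeilRank`, `additiveNewPartIndex`), one plain support
`def … : Prop` (DEFL: provable, print = Doyon–Lei 2021 Lemma 5.2; not yet proved in the tree — see its docstring), three `@[conjecture] def … : Prop`
(nothing asserted), one `example`.  Typer edits = this module docstring, the REF1 §95 / REF2 v25 §2 sentences and REF1 riders r1–r5 in the row
docstrings, cite-key normalisation (`Kato2004` ↦ `Kato2004Asterisque`; `DokchitserEvansWiersema2020` ADDED to references.bib).  No `instance`,
no `notation`, no Literature fact, no `sorry`.  Builder `tools/mk_add2.py`, published with the filed text under `HOME/MEMO-ty-data/g9/`.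
REF1-AUDIT §95 (g9, batch E, D-imc-ref1-22): SURVIVES as typed (DEFL support; W/SIGN/INC conjecture-grade), CLEARED to file; A1 rc 0, audit lemmas e1a–e7 axioms trio 9/9 (Probe95 153c0a5e4cf7a197); point (i) literal with the analytic `rootNumber` (e2a–c, e3); `/12` exact for every elliptic `W`, `R_n` model-invariant; independent recount DEFL 1 772 + 3×1 772, SIGN 4 074/4 074 (ranks) = 4 074/4 074 (root numbers), typed scope 4 034, INC 1 673/1 673 (1 121 both zero / 552 both positive), F1 not fired; KILLED none.
REF1-AUDIT §101 (g9, 2026-08-28T11:58:31Z): IMC-ADD2-DEFL is a KERNEL THEOREM — `additiveMazurTateDeflationAtTwo_holds` (`F1Sign2/AdditiveNewPartLawsAtTwoProofs.lean`, p630696) CERTIFIED (type = tree decl literally, 11/11 axioms ⊆ trio); §95 r4 withdrawn.  Sibling `F1Sign2/NewPartLawsAtTwo.lean` (p631009, REF1 §97/§99/§101, REF2 v26/v27) carries the semistable-inclusive rows IMC-NP2-SIGN/INC/LB over the same helpers.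
REF1-AUDIT §103 r1 (g9, 2026-08-28T12:04:40Z; answer to REF2 v27 §1.7 r1 — the honest dependency, not a hypothesis of the rows): `C ϖ * mazurTateElement f 2 n` is 2-integral in tree conventions on `NoRationalTwoTorsion` (θ_n ∈ ℤ_(2)[X] by `Sprung2017.mazurTateElement_two_eq` + `norm_ratPlusSymbol_two_le_two` + an odd Eisenstein annihilator, Chebotarev) and `ϖ` is a 2-adic unit WHEN the Manin constant `c₀` of the optimal curve is odd — proved for `4 ∤ N` (Abbes–Ullmo / Česnavičius 2018), but for the ADDITIVE curves of this file (`4 ∣ N_W`) nothing is in print: the rows W/SIGN/INC (and the NP2 rows on additive layers) silently assume `c₀` ODD (true throughout Cremona's tables, conjectural in general); a curve with even `c₀` would shift every `R_n` by `v₂(c₀)` (SIGN flips for `2 ∥ c₀`, W/INC shift). -imc optional check (§103 r3): raw `G_n`-coefficients of `θ_n` must have odd denominators dividing `#E₀(ℚ)_tors`.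
REF2-PLACEMENT v25 §2 (0fe067e0b1982f3b, D-imc-ref2-22): OBJECTS PRINT — θ_n at additive 2 with θ_0 = 0, cor θ_{n+1} = a₂θ_n = 0, λ ≥ 2^{n−1}, θ_n = ω_{n−1}·g_{n−1} (the planner's φ_n = Doyon–Lei's g_{n−1}) = Doyon–Lei 2021 Lemma 5.2 / Cor. 5.3 [arXiv:2103.06154 p. 9], where the behaviour of λ(θ_n) at additive p is an explicit OPEN QUESTION [p. 4]; the LAWS (SIGN, INC) at additive p = 2 are not in print beyond being consequences of BSD over ℚ_n, ℚ_{n−1} + Cassels–Tate + parity — grade VARIANT (BSD-term bookkeeping along the tower; prior use = Lei–Lim–Müller 2024 Thm 2 at p ≥ 5 potentially ordinary, Kobayashi, Kurihara, Pollack at good ss p, this cell's MTF2 at good ss 2); P-EVEN = in-print assembly (Kato 2004 Thm 14.2 (2) with λ ∣ 2, or Nekovář 2013 Thm A + DD 2011 Cor. 4.8); WEAK = MC-direction, open at additive 2 (no printed Λ-adic object); beyond-print theorem: no; refuted in print: nothing; riders r1–r8 (r6: a kernel derivation of SIGN from the functional equation — DEW 2021 Thm 38 pattern, Atkin–Li pseudo-eigenvalue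 at additive 2 — is the print-suggested attack, not carried out).

DESIGN (-imc §10.62, verbatim in substance). WHY: the 1 945 ADDITIVE X5 classes (`4 ∣ N`) had no finite-layer Iwasawa reading, and print stops
there: Doyon–Lei 2021 prove for additive `p` (incl. `p = 2`) only `cor θ_{n+1} = a_p θ_n` (Lemma 5.2) and `λ(θ_n) ≥ p^{n−1}` (Cor. 5.3) and ask
«what can be said about the Iwasawa invariants of θ_n … when E has additive reduction»; the odd-`p` additive theory (Delbourgo 1998;
Lei–Lim–Müller 2024) has no `p = 2` case.  Pre-registered BEFORE any output (`MEMO-imc-data/dimc22/README.md` ccf2eaf1565ad3e5; ADDENDUM 1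
079c7b42fb7b99f6 written after the θ job and BLIND to the Selmer output; kit tag `bsd-frontier-data`).  Population: all 1 772 non-CM curves with
`4 ∣ N ≤ 3 000`; tower `ℚ_n = ℚ(ζ_{2^{n+2}})⁺`.  θ-ENGINE j306010 (`theta.py` 0d3b9b7d39e9135c): `θ_n` = the tree's `mazurTateElement f 2 n` in the
record convention (= `C ϖ · mazurTateElement` of the typed rows, REF1 §78 A2), `n = 0..5`, exact coefficients, character norms, Tamagawa / Kodaira
/ conductor-exponent / `v(u)` data over `ℚ_n` for `n ≤ 3`, root numbers and twists by `−4, 8, −8`.  SELMER ENGINE A j306011 (the 1 052 curves with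
ODD torsion; two precision levels; a CELL = (curve, n) with both levels agreeing: 3 698 cells, 0 disagreements, 103 lost to
`local-image-not-saturated`).  Files `MEMO-imc-data/dimc22/final/` (rows22_theta 13336b7c4600696b, rows22_R 2debff3ad45108c0, rows22_Rstar
f4752420893bfd6c, cells22 f0932b51c1d03a32).  θ-SIDE STRUCTURE: `cor θ_{n+1} = a₂θ_n = 0` EXACTLY 8 860/8 860 and `θ_0 = 2[1/4]⁺ = 0` 1 772/1 772,
so `θ_n = ω_{n−1}·φ_n` with the DEFLATED NEW PART `φ_n` of degree `< 2^{n−1}`; the four supersingular laws transplanted verbatim: WEAK holds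
2 618/2 618, NONDEG / ♭-FLOOR / SANDWICH are FALSE (1 120 / 1 475 / 1 757 violating cells) — at additive 2 the `2^{n−1}` forced zeros are
arithmetically empty, the ± object is NOT Kurihara's pair but `φ_n`.

DERIVATION (-imc §10.63; BSD bookkeeping recorded so the referees can audit it; nothing here is claimed as a theorem).  Fix `E` additive at `2`
over `ℚ_n` and `ℚ_{n−1}`, odd torsion, `θ_n ≠ 0`.  (1) the new part of `θ_n` carries exactly the `2^{n−1}` conjugate values
`χ(θ_n) = τ-factor · L(E, χ̄, 1)/Ω`, `ord χ = 2^n`, and `L(E/ℚ_n, s) = L(E/ℚ_{n−1}, s)·∏_{ord χ = 2^n} L(E, χ, s)`; (2) `θ_n ≠ 0 ⇒ L(E, χ, 1) ≠ 0`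
for all new `χ` ⇒ (Kato) `rank E(ℚ_n) = rank E(ℚ_{n−1}) =: r`; (3) period over `ℚ_n` = `Ω_E^{2^n}·∏_{v ∣ 2}|u_{n,v}|_v^{−1}`,
`12·v_𝔭(u_n) = 2^n v₂(Δ_E) − ord_𝔭 Δ_min(E/ℚ_n)`; (4) no new rank and `E(ℚ_n)[2] = 0` ⇒ `v₂(Reg_n/Reg_{n−1}) = r`; (5) torsion odd; (6) local
Euler factor at `𝔭`: additive at both layers ⇒ `1` (the 16 `k₀ = 1` curves need a correction `ε_n` and are EXCLUDED from the typed rows).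
Collecting `v₂`: **`R_n := ℓ′_n − δu_n − δTam_n = r + v₂#Ш(E/ℚ_n)[2^∞] − v₂#Ш(E/ℚ_{n−1})[2^∞]`** (BSD-INC″).  THE SIGNED STATEMENT:
`(−1)^{R_n} = w(E/ℚ_{n−1}) = w(E)·w(E₈)` for `n ≥ 2`, and `(−1)^{R_1} = w(E)` — the sign at additive 2 is the PARITY of the Tate-corrected
𝔭-adic valuation of the deflated new part; its `n = 1` instance is «BSD₂ mod 2 for the rank-0 twist `E₈`» (-imc §10.65: the `n = 1` reading).
CENSUS = BC5 WITNESS (θ-side, ranks of `E`, `E₈` from Cremona's table, BLIND to the Selmer run): `R_n ≡` rank parity on **837 + 1 532 + 1 705 =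
4 074/4 074 cells** (4 034/4 034 inside the typed scope `k₀ = never`); `R*_n ≥ 0` AND EVEN on 4 074/4 074.  HONESTY LINE: the pre-registered
ADDENDUM-1 law «`R_n` even» (without the rank term) is FALSE on 1 981/4 074 cells — killed as stated; the rank term was found on the θ-side data
before the Selmer output was read.  SELMER SIDE (σ_{n−1} = 0 cells): `d_n = 0 ⟺ R*_n = 0` on 1 673/1 673, `0 ≤ d_n ≤ R*_n` and `d_n` even on
1 673/1 673.  HELD-OUT CONFIRMATION (-imc §10.65, D-imc-23, 11:07Z; 3 421 curves never used to find the law; predictions posted before the Selmer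
jobs): SIGN 6 068/6 068 new θ-cells (cumulative **10 142/10 142**), INC law on σ = 0 cells 859/859 (set A) + 3 064/3 064 (set B) (cumulative
**5 596/5 596**, 3 923 held-out), WEAK cumulative 9 149/9 149, DEFL `θ_0 = 0` on 4 466 curves and cor-exactness on 22 330 layer pairs.
WHY NOVEL (-imc, one sentence): at additive `p = 2` — where Doyon–Lei pose the behaviour of `θ_n` as an open question and no signed/± `p`-adic
`L`-function exists — the deflated new part of the Mazur–Tate element, corrected by purely local Tate-algorithm data up the totally ramified
`2`-tower, is an exact `2`-adic Ш-meter (parity = root number over the previous layer; excess over the rank = `v₂` of the new Ш); nearest print =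
BSD over number fields itself, DD 2010 Thm 1.3/1.4 and DEW 2021 (Thm 6/28/33/38: the printed templates of «norm relations constrain Ш-growth in
cyclic layers» and of parity-from-the-functional-equation; REF2 r7/r8 — «new regime for a printed mechanism», not «new mechanism»).
PARTITION: none moved; beyond-print theorem: no.  BSD is not proved by any of this.
bears_on: the cell's search question on the additive third of X5 (no route consumes these rows yet).
-/

noncomputable section

open scoped Classical MatrixGroups ModularForm NumberField

open CongruenceSubgroup Polynomial WeierstrassCurve Literature.NumberTheory.EllipticCurves
  Literature.NumberTheory.EllipticCurves.ModularForms
  Literature.NumberTheory.EllipticCurves.Rank1Residual ZpExtension IsDedekindDomain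

open Literature.Barriers.BirchSwinnertonDyer (nRankAtLeast)

namespace Summit.BirchSwinnertonDyer.Rank1Residual.F1Sign2

/-- `ℓ′_n(P) := v₂( N_{ℚ(ζ_{2^n})/ℚ} P(ζ_{2^n} − 1) )`, computed as the `2`-adic valuation of the resultant of `P` with
`Φ_{2^n}(X + 1)` (the minimal polynomial of `ζ_{2^n} − 1`; the resultant with a monic irreducible polynomial is the norm of the
value at a root, up to sign). For `P = θ_n` this is `v₂` of the norm of `χ(θ_n)` for any character `χ` of `Gal(ℚ_n/ℚ)` of exact
order `2^n` (the NEW part of `θ_n`). Junk: `v₂(0) = 0` — REF1 §95 r5: for `4 ∣ N_W` and `θ_n ≠ 0` the resultant is non-zero (the old part of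
`θ_n` vanishes identically by DEFL and the new character values are Galois-conjugate), so the junk never fires on the rows' scope. -/
def newPartNormTwoVal (n : ℕ) (P : ℚ[X]) : ℤ :=
  padicValRat 2 (Polynomial.resultant ((Polynomial.cyclotomic (2 ^ n) ℚ).comp (X + 1)) P)

/-- `D_n := Σ_{v ∣ 2} ord_v Δ_min(W/ℚ_n)`: the sum over the primes `v` of the `n`-th layer `ℚ_n = κ.layer n` above `2` of the
order of the minimal discriminant of `W/ℚ_n` at `v` (for the cyclotomic `ℤ₂`-extension there is exactly one such `v`, totally
ramified, so `D_n = ord_𝔭 Δ_min(W/ℚ_n)`; the `finsum` avoids naming it). -/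
def layerTwoMinDiscOrd (W : WeierstrassCurve ℚ) (κ : ZpExtension ℚ 2) (n : ℕ) : ℕ :=
  haveI : FiniteDimensional ℚ ↥(κ.layer n) := κ.finiteDimensional_layer_holds n
  haveI : NumberField ↥(κ.layer n) := NumberField.of_module_finite ℚ ↥(κ.layer n)
  ∑ᶠ v : HeightOneSpectrum (𝓞 ↥(κ.layer n)),
    if (2 : 𝓞 ↥(κ.layer n)) ∈ v.asIdeal then (W.baseChange ↥(κ.layer n)).ordMinimalDiscriminant v else 0

/-- `W/ℚ_n` has ADDITIVE reduction at every prime of `ℚ_n = κ.layer n` above `2`. -/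
def LayerAdditiveAboveTwo (W : WeierstrassCurve ℚ) (κ : ZpExtension ℚ 2) (n : ℕ) : Prop :=
  haveI : FiniteDimensional ℚ ↥(κ.layer n) := κ.finiteDimensional_layer_holds n
  haveI : NumberField ↥(κ.layer n) := NumberField.of_module_finite ℚ ↥(κ.layer n)
  ∀ v : HeightOneSpectrum (𝓞 ↥(κ.layer n)), (2 : 𝓞 ↥(κ.layer n)) ∈ v.asIdeal →
    (W.baseChange ↥(κ.layer n)).HasAdditiveReductionAt v

/-- `rank E(ℚ_n)`: the Mordell–Weil rank of `W` over the `n`-th layer. -/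
def layerMordellWeilRank (W : WeierstrassCurve ℚ) (κ : ZpExtension ℚ 2) (n : ℕ) : ℕ :=
  (W.baseChange ↥(κ.layer n)).mordellWeilRank

/-- **The corrected new-part valuation `R_n`** (`n ≥ 1`; `θ = (θ_m)_m` the period-normalised Mazur–Tate elements, `W` globally
minimal over `ℚ`):  `R_n := ℓ′_n(θ_n) − δu_n − δTam_n`, where `δu_n := v_𝔭(u_n) − v_𝔭′(u_{n−1}) = (2^{n−1}·v₂(Δ_W) + D_{n−1} − D_n)/12`
is the change of the local minimal-model scaling at the prime above `2` between layers `n − 1` and `n` (`12·v(u_n) = 2^n v₂(Δ_W) − D_n`),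
and `δTam_n := v₂ Tam(W/ℚ_n) − v₂ Tam(W/ℚ_{n−1})` (all bad primes). Under BSD for `W` over `ℚ_n` and `ℚ_{n−1}` and additivity above `2`
at both layers, `R_n = rank E(ℚ_{n−1}) + v₂ #Ш(W/ℚ_n)[2^∞] − v₂ #Ш(W/ℚ_{n−1})[2^∞] + 2·(torsion/index terms)` (module docstring of the filing). -/
def additiveNewPartIndex {N : ℕ} (f : CuspForm (Gamma0 N) 2) (W : WeierstrassCurve ℚ) (ϖ : ℚ)
    (κ : ZpExtension ℚ 2) (n : ℕ) : ℤ :=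
  newPartNormTwoVal n (C ϖ * mazurTateElement f 2 n)
    - (((2 : ℤ) ^ (n - 1) * padicValRat 2 W.Δ + (layerTwoMinDiscOrd W κ (n - 1) : ℤ) - (layerTwoMinDiscOrd W κ n : ℤ)) / 12)
    - ((layerTamagawaTwoVal W κ n : ℤ) - (layerTamagawaTwoVal W κ (n - 1) : ℤ))

/-- **IMC-ADD2-DEFL `AdditiveMazurTateDeflationAtTwo`** (support, provable from the distribution relation with `a₂(f) = 0`):
for the newform `f` of a curve `W/ℚ` additive at `2` (`4 ∣ N_W`), `θ_0(f) = 0` and `ω_{n−1} = (1+T)^{2^{n−1}} − 1` divides `θ_n(f)`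
in `ℚ[T]` for every `n ≥ 1` (equivalently `cor^{n}_{n−1} θ_n = a₂ θ_{n−1} = 0`; Doyon–Lei 2021 Lemma 5.2). Census D-imc-22: `θ_0 = 0`
1 772/1 772, `cor θ_{n+1} = 0` 8 860/8 860 (`N ≤ 3 000`, `n ≤ 5`); held-out D-imc-23: `θ_0 = 0` on 4 466 curves, cor-exactness on 22 330 layer pairs.
REF1 §95: SURVIVES as typed, support, CLEARED (plain def; recount 1 772/1 772 and `ω_{n−1} ∣ θ_n` re-derived from the coefficient vectors
1 772/1 772 for each `n = 1, 2, 3`); r4: «provable» is MODULO the symbol-level `U₂`-relation at `4 ∣ N` (`Σ_{b mod 2} [(r+b)/2]⁺_f = a₂(f)·[r]⁺_f`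
with `a₂(f) = 0`), which the tree has only for `¬ p ∣ N` (`intCast_mul_ratPlusSymbol`) and `p ∥ N` (Atkin–Lehner), not for `p² ∣ N` — a
Literature statement to add [MTT 1986 §4 (4.2)].  REF2 v25 §2: the object is PRINT (Doyon–Lei 2021 Lemma 5.2 / Cor. 5.3, proof «See [MT]»;
`φ_n` = their `g_{n−1}`).
PROVED (seat -ty g9, 2026-08-28T11:46Z): `additiveMazurTateDeflationAtTwo_holds : AdditiveMazurTateDeflationAtTwo` in the sibling THEOREMS-ONLY
module `F1Sign2/AdditiveNewPartLawsAtTwoProofs.lean` (p630696, 269 l., axioms trio) — from the tree's symbol-level `U₂`-relation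
`intCast_mul_ratPlusSymbol_of_dvd` (ANY `p ∣ N`, MTT 1986 §I.4 (4.2); with `a₂(f) = 0`: `[x/2]⁺ + [(x+1)/2]⁺ = 0`, whence `[1/4]⁺ = 0` and
`[a/2^{n+1} + 1/2]⁺ = −[a/2^{n+1}]⁺`) and `ratPlusSymbol` periodicity alone, so REF1 §95 r4's «modulo the symbol-level `U₂`-relation at `p² ∣ N`,
which the tree lacks» was mistaken about the tree and §95 r4 is WITHDRAWN (REF1 §101, 11:58:31Z: «p630696 ADD2-DEFL CERTIFIED as kernel theorem —
type = tree decl literally, 11/11 axioms ⊆ trio»).  Users of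
`(h : AdditiveMazurTateDeflationAtTwo)` are fed `additiveMazurTateDeflationAtTwo_holds`; «old part vanishes on additive layers» in the
W/SIGN/INC rows below and in `F1Sign2/NewPartLawsAtTwo.lean` may cite that theorem instead of MTT / Doyon–Lei (REF1 §101).
[cite: DoyonLei2021, Lemma 5.2, Cor. 5.3] [cite: MazurTateTeitelbaum1986, §4] -/
def AdditiveMazurTateDeflationAtTwo : Prop :=
  ∀ {N : ℕ} [NeZero N] (f : CuspForm (Gamma0 N) 2) (W : WeierstrassCurve ℚ) [W.IsElliptic],
    IsNewformOf W f → 4 ∣ W.conductorNorm ℤ →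
    mazurTateElement f 2 0 = 0 ∧
      ∀ n : ℕ, 1 ≤ n → ((X + 1) ^ (2 ^ (n - 1)) - 1 : ℚ[X]) ∣ mazurTateElement f 2 n

/-- **IMC-ADD2-W `MazurTateFittingShadowAdditiveAtTwoLe`** — candidate, conjecture-grade: the WEAK `𝔽₂`-Fitting shadow
(`MazurTateFittingShadowAtTwoLe`) transplanted from good supersingular to ADDITIVE reduction at `2`: for `W/ℚ` globally minimal,
non-CM, `4 ∣ N_W`, `W(ℚ)[2] = 0` (hence `W(ℚ_n)[2] = 0` for all `n`: `[ℚ(W[2]) : ℚ] ∈ {3, 6}` has no subfield of `2`-power degree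
`> 1` other than possibly `ℚ(√Δ)`, which does not contain a `2`-torsion point), newform `f`, period pin and `2`-integral `θ_n`:
`rk₂ Sel_{2^∞}(W/ℚ_n) ≥ k ⇒ k ≤ m_n` for `k ≤ 2^n` (`m_n = mtPairShadow`). Census D-imc-22 (engine A, two precision levels
agreeing): `min(s_n, 2^n) ≤ m_n` on 2 618/2 618 layer-cells (`n = 1, 2, 3`; 1 046 curves, `N ≤ 3 000`); the companion NONDEG /
♭-FLOOR / SANDWICH transplants are FALSE there (1 120 / 1 475 / 1 757 violating cells); held-out D-imc-23: 1 400/1 400 + 5 131/5 131 (cumulative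
9 149/9 149). Nothing in print at additive `p = 2` (Doyon–Lei 2021 treat `θ_n` only; Kim–Kurihara is odd `p`, good reduction).
HONEST (-imc): weak content — `s_n ≤ 4` throughout, so the law is barely exercised at `n ≥ 3`; filed because it is the only surviving transplant.
REF1 §95: SURVIVES, conjecture-grade (weak transplant), CLEARED.  REF2 v25 §2.5: WEAK = main-conjecture direction, OPEN at additive 2 (no printed
Λ-adic object); qualitative part print (Kato 2004 Thm 14.2).  [cite: KimKurihara2021] [cite: Kato2004Asterisque, Thm. 14.2] -/
@[conjecture] def MazurTateFittingShadowAdditiveAtTwoLe : Prop :=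
  ∀ {N : ℕ} [NeZero N] (f : CuspForm (Gamma0 N) 2) (W : WeierstrassCurve ℚ) [W.IsElliptic] [W.IsGloballyMinimal]
    (ϖ : ℚ), IsNewformOf W f → 4 ∣ W.conductorNorm ℤ → ¬ W.HasCM → NoRationalTwoTorsion W →
    (ϖ : ℝ) * W.realPeriodRat = plusPeriod f →
    (∀ n i : ℕ, 0 ≤ padicValRat 2 ((C ϖ * mazurTateElement f 2 n).coeff i)) →
    ∀ (κ : ZpExtension ℚ 2), κ.IsCyclotomic →
    ∀ n k : ℕ, 1 ≤ n → k ≤ 2 ^ n →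
      nRankAtLeast (↥(W.selmerLayer κ n)) 2 k →
        (k : ℕ∞) ≤ mtPairShadow (fun m ↦ C ϖ * mazurTateElement f 2 m) n

/-- **IMC-ADD2-SIGN `AdditiveNewPartSignLawAtTwo`** — candidate, conjecture-grade (a consequence of BSD₂ for `W` over `ℚ_n` and
`ℚ_{n−1}` together with the parity conjecture; OPEN as stated): THE SIGNED OBJECT AT ADDITIVE `2`. For `W/ℚ` globally minimal, non-CM,
`4 ∣ N_W`, `W(ℚ)[2] = 0`, newform `f`, period pin `ϖ·Ω(W) = Ω⁺_f`, the cyclotomic `ℤ₂`-extension `κ`, and a layer `n ≥ 1` such that `W`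
is still additive above `2` over `ℚ_n` and `ℚ_{n−1}` and `θ_n ≠ 0`:
`R_n ≡ 0 (mod 2) ⟺ w(W)·w(W^{(2)}) = +1`, i.e. `(−1)^{R_n} = w(W/ℚ(√2)) = w(W/ℚ_{n−1})` (for `n = 1`, `θ_1 ≠ 0` forces
`L(W^{(2)},1) ≠ 0`, so `w(W^{(2)}) = +1` and the law reads `(−1)^{R_1} = w(W)`). Census D-imc-22 (θ-side, `N ≤ 3 000`, non-CM, odd
torsion, `n ≤ 3`, Mordell–Weil ranks of `W`, `W^{(2)}` from Cremona's table): `R_n ≡ rank W(ℚ) + rank W^{(2)}(ℚ)·[n ≥ 2]` on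
4 074/4 074 cells with `θ_n ≠ 0` (837 + 1 532 + 1 705), and `θ_1 ≠ 0 ⇒ w(W^{(2)}) = +1` on 837/837. The uncorrected parity
(`ℓ′_n` alone, or `R_n` without the rank term) is FALSE on 1 981/4 074 cells: every term is load-bearing.
REF1 §95 (riders r1–r3): typed scope `n < k₀` 4 034/4 034; the 40 cells of the 16 curves semistable over `ℚ(√2)` need the Euler correction `ε` at
`n = k₀ = 1` — 13/13 fail without it — and none above it, 27/27; right side checked BOTH with Cremona ranks (parity) and with root numbers (`w` of
`W` and of the twist `d = 8`, Cremona `allcurves` sign column): 4 074/4 074 each (REF1 T2; parity-consistency `w = (−1)^{rank}` 1 772/1 772);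
point (i) is literal with the tree's analytic `rootNumber` (at `n = 1`, `θ_1 ≠ 0` forces `L(W^{(2)},1) ≠ 0` hence `w(W^{(2)}) = +1`, no parity
conjecture needed; kernel e2a–c, e3: `W.quadraticTwist 2` = twist by `χ_8`); the hypotheses `¬HasCM`, `NoRationalTwoTorsion`,
`IsGloballyMinimal` are not used by the BSD-consequence derivation and are kept to match the census scope (BC7 ask D-ref1-imc-22a pending);
`R_n` is model-invariant (`W ↦ u·W` shifts `ℓ′_n` and `δu_n` by the same `2^{n−1}v₂(u)`).  HELD-OUT (-imc §10.65, D-imc-23): 6 068/6 068 new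
θ-cells on 3 421 curves never used to find the law, cumulative 10 142/10 142.  REF1 verdict: SURVIVES as typed, conjecture-grade, CLEARED —
THE ± OBJECT AT ADDITIVE 2.  REF2 v25 §2.5/§2.7: grade VARIANT (BSD₂-over-layers + Cassels–Tate + parity consequence, OPEN as stated; not in print
at additive 2); r6: a kernel derivation from the functional equation alone (evenness of `v_π` on `ℚ(ζ_{2^n})⁺` + the phase of the primitive value,
DEW 2021 Thm 38 pattern with the Atkin–Li pseudo-eigenvalue at additive 2) is the print-suggested attack — not carried out; if it succeeds a
`_holds` theorem lands in a sibling module and this tag becomes moot.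
[cite: DoyonLei2021, §5] [cite: DokchitserDokchitser2010, Thm. 1.3, 1.4] [cite: DokchitserEvansWiersema2020, Thm. 38] [cite: WiersemaWuthrich2022, Thm. 2] -/
@[conjecture] def AdditiveNewPartSignLawAtTwo : Prop :=
  ∀ {N : ℕ} [NeZero N] (f : CuspForm (Gamma0 N) 2) (W : WeierstrassCurve ℚ) [W.IsElliptic] [W.IsGloballyMinimal]
    (ϖ : ℚ), IsNewformOf W f → 4 ∣ W.conductorNorm ℤ → ¬ W.HasCM → NoRationalTwoTorsion W →
    (ϖ : ℝ) * W.realPeriodRat = plusPeriod f →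
    ∀ (κ : ZpExtension ℚ 2), κ.IsCyclotomic →
    ∀ n : ℕ, 1 ≤ n → LayerAdditiveAboveTwo W κ (n - 1) → LayerAdditiveAboveTwo W κ n →
      mazurTateElement f 2 n ≠ 0 →
      (Even (additiveNewPartIndex f W ϖ κ n) ↔ W.rootNumber * (W.quadraticTwist 2).rootNumber = 1)

/-- **IMC-ADD2-INC `AdditiveNewPartShaIncrementAtTwo`** — candidate, conjecture-grade (BSD₂ over the layers + Cassels–Tate;
OPEN): the corrected new-part valuation MEASURES THE NEW `2`-PART OF Ш. Same frame as `AdditiveNewPartSignLawAtTwo`; put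
`r := rank W(ℚ_{n−1})` and `R*_n := R_n − r`. If `Sel_{2^∞}(W/ℚ_{n−1})` has `2`-rank `≤ r` (i.e. `Ш(W/ℚ_{n−1})[2] = 0`), then:
(a) `R*_n ≥ 0`; (b) `rk₂ Sel_{2^∞}(W/ℚ_n) ≤ r + R*_n`; (c) if `R*_n ≥ 1` then `rk₂ Sel_{2^∞}(W/ℚ_n) ≥ r + 2`
(so `Sel` grows at layer `n` iff `R*_n > 0`, and by at most `R*_n`). Census D-imc-22 (engine A two-level cells joined with the θ-side,
`σ_{n−1} = 0` cells, `n ≤ 3`): `d_n = 0 ⟺ R*_n = 0` on 1 673/1 673 (1 127 both zero, 546 both positive), `0 ≤ d_n ≤ R*_n` and `d_n`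
even on 1 673/1 673; joint `(d_n, R*_n)`: (2,2) 396 · (2,4) 64 · (2,6) 19 · (2,8) 3 · (4,4) 53 · (4,6) 11 · (4,8) 5 · (4,10) 1;
`R*_n ≥ 0` and even on all 4 074 θ-cells. KILL: one cell with `σ_{n−1} = 0`, `θ_n ≠ 0` and (`R*_n = 0 < d_n` or `d_n > R*_n` or
`R*_n > 0 = d_n`).
REF1 §95 r1 (recount, corrects the split above): 1 673/1 673 MAIN cells = **1 121 both zero, 552 both positive** (typed scope 1 645/1 645; plus 8/8
smoke cells — «1 127» is the smoke-inclusive both-zero count); joint `(d_n, R*_n)` by layer as in REF1 §95 T3; F1 (the KILL above) not fired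
(0/1 673); `r` here is the TRUE rank of `W(ℚ_{n−1})` (cleaner than the census's BSD-predicted `r^{min}`); clause (b) is `rk₂ Sel_n ≤ R_n = r + R*_n`
(e7).  HELD-OUT (-imc §10.65): law on σ = 0 cells 859/859 (set A, 2 000 < N ≤ 3 000) + 3 064/3 064 (set B, 3 000 < N ≤ 6 000), cumulative
5 596/5 596 (3 923 held-out); strict cells `2 ≤ d_n < R*_n` (predicted elements of order ≥ 4 in the new Ш) 103 + 58 + 240 = 401, second engine
(4-descent / Cassels–Tate over `ℚ(√2)`) = D-imc-23 (2), open.  REF1 verdict: SURVIVES as typed, conjecture-grade, CLEARED.  REF2 v25 §2.5: VARIANT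
(BSD₂ over the layers + Cassels–Tate), open; the «≤» clause (b) is the Ш[2]-level Kato-direction statement (-an D-an-48).
[cite: DoyonLei2021, §5] [cite: Nekovar2013, Thm. A] [cite: Kato2004Asterisque, Thm. 14.2] -/
@[conjecture] def AdditiveNewPartShaIncrementAtTwo : Prop :=
  ∀ {N : ℕ} [NeZero N] (f : CuspForm (Gamma0 N) 2) (W : WeierstrassCurve ℚ) [W.IsElliptic] [W.IsGloballyMinimal]
    (ϖ : ℚ), IsNewformOf W f → 4 ∣ W.conductorNorm ℤ → ¬ W.HasCM → NoRationalTwoTorsion W →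
    (ϖ : ℝ) * W.realPeriodRat = plusPeriod f →
    ∀ (κ : ZpExtension ℚ 2), κ.IsCyclotomic →
    ∀ n : ℕ, 1 ≤ n → LayerAdditiveAboveTwo W κ (n - 1) → LayerAdditiveAboveTwo W κ n →
      mazurTateElement f 2 n ≠ 0 →
      ¬ nRankAtLeast (↥(W.selmerLayer κ (n - 1))) 2 (layerMordellWeilRank W κ (n - 1) + 1) →
      0 ≤ additiveNewPartIndex f W ϖ κ n - layerMordellWeilRank W κ (n - 1) ∧
      (∀ k : ℕ, nRankAtLeast (↥(W.selmerLayer κ n)) 2 k →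
          (k : ℤ) ≤ additiveNewPartIndex f W ϖ κ n) ∧
      (1 ≤ additiveNewPartIndex f W ϖ κ n - layerMordellWeilRank W κ (n - 1) →
          nRankAtLeast (↥(W.selmerLayer κ n)) 2 (layerMordellWeilRank W κ (n - 1) + 2))

/-! ### Sanity examples (definitions compute on closed terms where possible) -/

example : newPartNormTwoVal 0 0 = 0 := by
  simp [newPartNormTwoVal]

end Summit.BirchSwinnertonDyer.Rank1Residual.F1Sign2

end
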